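import Summits.RiemannHypothesis.RiemannHypothesis.Theorems.PfPersistenceLocalityBarrier
import HarnessLib

/-!
# The integral representation of `thetaEven` (pub-rhpf fake-4; mechanism/rigidity campaign; no RH claims)

**PROVED**: `thetaEven L n m y = ∫ x in (-(L/2))..(L/2 - y), xiEven L n x * xiEven L m (x + y)` for `0 < L`
and ALL real `y` — the closed-form kernel of the even block (Connes–Consani Lemma 2.6, `thetaEven`) IS the
windowed autocorrelation of the cosine modes `xiEven`. This is the tree input named missing in the docstring
of `PrimePatternFormBounded`; its consequences (pattern form = profile autocorrelation, the Galerkin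
DOWN-CONE lemma, the guarded one-prime form bound) are in `PfPersistenceGalerkinDownCone`.
Proof: shift to `u = x + L/2 ∈ [0, L − y]`, where the `(−1)^n` in `xiEven` turns the modes into plain
cosines `√(2/L) cos(2πnu/L)`, product-to-sum, and `∫ cos(cu + d) = (sin(cb + d) − sin(ca + d))/c`; the
endpoint phases are integer multiples of `2π` minus `2πny/L`.
-/

set_option linter.dupNamespace false

noncomputable section

namespace Summit.RiemannHypothesis.RiemannHypothesis.Theorems.PfPersistence

open Real intervalIntegral MeasureTheory Set Matrix

/-! ## 1. Trig integrals -/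

/-- `∫_a^b cos(c u + d) du = (sin(c b + d) − sin(c a + d))/c`. [folklore] -/
theorem integral_cos_linear {c : ℝ} (hc : c ≠ 0) (d a b : ℝ) :
    ∫ u in a..b, Real.cos (c * u + d) = (Real.sin (c * b + d) - Real.sin (c * a + d)) / c := by
  rw [intervalIntegral.integral_comp_mul_add Real.cos hc d, integral_cos, smul_eq_mul]
  field_simp

/-- `∫_a^b cos(c u) du = (sin(c b) − sin(c a))/c`. [folklore] -/
theorem integral_cos_mul {c : ℝ} (hc : c ≠ 0) (a b : ℝ) :
    ∫ u in a..b, Real.cos (c * u) = (Real.sin (c * b) - Real.sin (c * a)) / c := by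
  rw [intervalIntegral.integral_comp_mul_left Real.cos hc, integral_cos, smul_eq_mul]
  field_simp

/-- `2 cos A cos B = cos (A − B) + cos (A + B)`. [folklore] -/
theorem two_mul_cos_mul_cos' (A B : ℝ) :
    2 * (Real.cos A * Real.cos B) = Real.cos (A - B) + Real.cos (A + B) := by
  rw [Real.cos_sub, Real.cos_add]; ring

/-! ## 2. The modes in the shifted coordinate `u = x + L/2 ∈ [0, L]` -/

/-- The constant mode `ξ_0 = 1/√L`. [folklore] -/
theorem xiEven_zero (L x : ℝ) : xiEven L 0 x = 1 / Real.sqrt L := by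
  simp [xiEven]

/-- For `n ≠ 0`: `ξ_n(u − L/2) = √(2/L) cos(2π n u / L)` — the `(−1)^n` in `xiEven` makes the modes plain
cosines on `[0, L]`. [folklore] -/
theorem xiEven_sub_half {L : ℝ} (hL : L ≠ 0) {n : ℕ} (hn : n ≠ 0) (u : ℝ) :
    xiEven L n (u - L / 2) = Real.sqrt (2 / L) * Real.cos (2 * π * n * u / L) := by
  have harg : 2 * π * n * (u - L / 2) / L = 2 * π * n * u / L - n * π := by
    field_simp
  simp only [xiEven, hn, if_false]
  rw [harg, Real.cos_sub_nat_mul_pi]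
  have h1 : ((-1 : ℝ) ^ n) * (-1) ^ n = 1 := by
    rw [← mul_pow]; norm_num
  calc (-1 : ℝ) ^ n * Real.sqrt (2 / L) * ((-1) ^ n * Real.cos (2 * π * n * u / L))
        = ((-1 : ℝ) ^ n * (-1) ^ n) * (Real.sqrt (2 / L) * Real.cos (2 * π * n * u / L)) := by ring
    _ = Real.sqrt (2 / L) * Real.cos (2 * π * n * u / L) := by rw [h1, one_mul]

/-- Shift of the integration variable: `∫_{-L/2}^{L/2-y} F = ∫_0^{L-y} F(· − L/2)`. [folklore] -/
theorem integral_shift_half (F : ℝ → ℝ) (L y : ℝ) :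
    ∫ x in (-(L / 2))..(L / 2 - y), F x = ∫ u in (0:ℝ)..(L - y), F (u - L / 2) := by
  rw [intervalIntegral.integral_comp_sub_right F (L / 2)]
  have h1 : (0:ℝ) - L / 2 = -(L / 2) := by ring
  have h2 : L - y - L / 2 = L / 2 - y := by ring
  rw [h1, h2]

/-! ## 3. The four cases -/

/-- `√(2/L)·√(2/L) = 2/L`. [folklore] -/
theorem sqrt_two_div_mul {L : ℝ} (hL : 0 < L) :
    Real.sqrt (2 / L) * Real.sqrt (2 / L) = 2 / L :=
  Real.mul_self_sqrt (by positivity)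

/-- `(1/√L)·√(2/L) = √2/L`. [folklore] -/
theorem inv_sqrt_mul_sqrt_two_div {L : ℝ} (hL : 0 < L) :
    1 / Real.sqrt L * Real.sqrt (2 / L) = Real.sqrt 2 / L := by
  rw [Real.sqrt_div' 2 hL.le]
  have hs : Real.sqrt L ≠ 0 := (Real.sqrt_pos.2 hL).ne'
  have hs2 : Real.sqrt L ^ 2 = L := Real.sq_sqrt hL.le
  field_simp
  rw [hs2]

/-- Case `n = m = 0`. -/
theorem theta_integral_zero_zero {L : ℝ} (hL : 0 < L) (y : ℝ) :
    ∫ x in (-(L / 2))..(L / 2 - y), xiEven L 0 x * xiEven L 0 (x + y) = (L - y) / L := by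
  simp only [xiEven_zero]
  rw [intervalIntegral.integral_const, smul_eq_mul]
  have hs : Real.sqrt L ^ 2 = L := Real.sq_sqrt hL.le
  have hs0 : Real.sqrt L ≠ 0 := (Real.sqrt_pos.2 hL).ne'
  field_simp
  rw [hs]
  ring


/-- The integral in the shifted coordinate. -/
theorem theta_integral_shift (L y : ℝ) (n m : ℕ) :
    ∫ x in (-(L / 2))..(L / 2 - y), xiEven L n x * xiEven L m (x + y)
      = ∫ u in (0:ℝ)..(L - y), xiEven L n (u - L / 2) * xiEven L m (u - L / 2 + y) :=
  integral_shift_half (fun x => xiEven L n x * xiEven L m (x + y)) L y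

/-- The translated mode in the shifted coordinate: `ξ_m(u − L/2 + y) = √(2/L) cos((2πm/L) u + 2πm y/L)`. [folklore] -/
theorem xiEven_sub_half_add {L : ℝ} (hL : L ≠ 0) {m : ℕ} (hm : m ≠ 0) (u y : ℝ) :
    xiEven L m (u - L / 2 + y) = Real.sqrt (2 / L) * Real.cos (2 * π * m / L * u + 2 * π * m * y / L) := by
  rw [show u - L / 2 + y = (u + y) - L / 2 by ring, xiEven_sub_half hL hm]
  congr 1; congr 1; ring

/-- `√2·√2 = 2`. [folklore] -/
theorem sqrt_two_mul_sqrt_two : Real.sqrt 2 * Real.sqrt 2 = 2 := Real.mul_self_sqrt (by norm_num)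

/-- Case `n = 0`, `m ≠ 0`. -/
theorem theta_integral_zero_left {L : ℝ} (hL : 0 < L) {m : ℕ} (hm : m ≠ 0) (y : ℝ) :
    ∫ x in (-(L / 2))..(L / 2 - y), xiEven L 0 x * xiEven L m (x + y)
      = -Real.sin (2 * π * m * y / L) / (Real.sqrt 2 * π * m) := by
  have hL0 : L ≠ 0 := hL.ne'
  have hmR : (m : ℝ) ≠ 0 := Nat.cast_ne_zero.2 hm
  have hc : 2 * π * m / L ≠ 0 := by positivity
  have hf : (fun u => xiEven L 0 (u - L / 2) * xiEven L m (u - L / 2 + y))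
      = fun u => (1 / Real.sqrt L * Real.sqrt (2 / L)) * Real.cos (2 * π * m / L * u + 2 * π * m * y / L) := by
    funext u; rw [xiEven_zero, xiEven_sub_half_add hL0 hm]; ring
  rw [theta_integral_shift, hf, intervalIntegral.integral_const_mul, integral_cos_linear hc,
    inv_sqrt_mul_sqrt_two_div hL]
  have e1 : 2 * π * m / L * (L - y) + 2 * π * m * y / L = ((2 * m : ℕ) : ℝ) * π := by
    push_cast; field_simp; ring
  rw [e1, Real.sin_nat_mul_pi, mul_zero, zero_add]
  have h2 := sqrt_two_mul_sqrt_two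
  have hs2 : Real.sqrt 2 ≠ 0 := by positivity
  field_simp
  linear_combination (-(Real.sin (2 * π * m * y / L))) * h2

/-- Case `n ≠ 0`, `m = 0`. -/
theorem theta_integral_zero_right {L : ℝ} (hL : 0 < L) {n : ℕ} (hn : n ≠ 0) (y : ℝ) :
    ∫ x in (-(L / 2))..(L / 2 - y), xiEven L n x * xiEven L 0 (x + y)
      = -Real.sin (2 * π * n * y / L) / (Real.sqrt 2 * π * n) := by
  have hL0 : L ≠ 0 := hL.ne'
  have hnR : (n : ℝ) ≠ 0 := Nat.cast_ne_zero.2 hn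
  have hc : 2 * π * n / L ≠ 0 := by positivity
  have hf : (fun u => xiEven L n (u - L / 2) * xiEven L 0 (u - L / 2 + y))
      = fun u => (1 / Real.sqrt L * Real.sqrt (2 / L)) * Real.cos (2 * π * n / L * u) := by
    funext u; rw [xiEven_zero, xiEven_sub_half hL0 hn]
    rw [show 2 * π * n * u / L = 2 * π * n / L * u by ring]; ring
  rw [theta_integral_shift, hf, intervalIntegral.integral_const_mul, integral_cos_mul hc,
    inv_sqrt_mul_sqrt_two_div hL]
  have e1 : 2 * π * n / L * (L - y) = ((2 * n : ℕ) : ℝ) * π - 2 * π * n * y / L := by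
    push_cast; field_simp
  have e2 : Real.sin (2 * π * n / L * (L - y)) = -Real.sin (2 * π * n * y / L) := by
    have hpow : ((-1 : ℝ) ^ (2 * n)) = 1 := by rw [pow_mul]; norm_num
    rw [e1, Real.sin_sub, Real.sin_nat_mul_pi, Real.cos_nat_mul_pi, hpow]; ring
  rw [e2, mul_zero, Real.sin_zero, sub_zero]
  have h2 := sqrt_two_mul_sqrt_two
  have hs2 : Real.sqrt 2 ≠ 0 := by positivity
  field_simp
  linear_combination (-(Real.sin (2 * π * n * y / L))) * h2

/-- Case `n = m ≠ 0`. -/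
theorem theta_integral_diag {L : ℝ} (hL : 0 < L) {n : ℕ} (hn : n ≠ 0) (y : ℝ) :
    ∫ x in (-(L / 2))..(L / 2 - y), xiEven L n x * xiEven L n (x + y)
      = (L - y) / L * Real.cos (2 * π * n * y / L) - Real.sin (2 * π * n * y / L) / (2 * π * n) := by
  have hL0 : L ≠ 0 := hL.ne'
  have hnR : (n : ℝ) ≠ 0 := Nat.cast_ne_zero.2 hn
  have hc : 4 * π * n / L ≠ 0 := by positivity
  have hf : (fun u => xiEven L n (u - L / 2) * xiEven L n (u - L / 2 + y))
      = fun u => (1 / L) * Real.cos (2 * π * n * y / L)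
          + (1 / L) * Real.cos (4 * π * n / L * u + 2 * π * n * y / L) := by
    funext u
    rw [xiEven_sub_half hL0 hn, xiEven_sub_half_add hL0 hn]
    have hprod := two_mul_cos_mul_cos' (2 * π * n * u / L) (2 * π * n / L * u + 2 * π * n * y / L)
    have hA : 2 * π * n * u / L - (2 * π * n / L * u + 2 * π * n * y / L) = -(2 * π * n * y / L) := by ring
    have hB : 2 * π * n * u / L + (2 * π * n / L * u + 2 * π * n * y / L)
        = 4 * π * n / L * u + 2 * π * n * y / L := by ring
    rw [hA, hB, Real.cos_neg] at hprod
    have hsq := sqrt_two_div_mul hL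
    calc Real.sqrt (2 / L) * Real.cos (2 * π * n * u / L)
          * (Real.sqrt (2 / L) * Real.cos (2 * π * n / L * u + 2 * π * n * y / L))
        = (Real.sqrt (2 / L) * Real.sqrt (2 / L)) / 2
          * (2 * (Real.cos (2 * π * n * u / L) * Real.cos (2 * π * n / L * u + 2 * π * n * y / L))) := by
            ring
      _ = (2 / L) / 2 * (Real.cos (2 * π * n * y / L)
          + Real.cos (4 * π * n / L * u + 2 * π * n * y / L)) := by rw [hsq, hprod]
      _ = _ := by ring
  have hi1 : IntervalIntegrable (fun u : ℝ => (1 / L) * Real.cos (2 * π * n * y / L)) volume 0 (L - y) :=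
    intervalIntegrable_const
  have hi2 : IntervalIntegrable
      (fun u : ℝ => (1 / L) * Real.cos (4 * π * n / L * u + 2 * π * n * y / L)) volume 0 (L - y) :=
    (by fun_prop : Continuous fun u : ℝ => (1 / L) * Real.cos (4 * π * n / L * u + 2 * π * n * y / L)).intervalIntegrable _ _
  rw [theta_integral_shift, hf, intervalIntegral.integral_add hi1 hi2, intervalIntegral.integral_const,
    intervalIntegral.integral_const_mul, integral_cos_linear hc, smul_eq_mul]
  have e1 : 4 * π * n / L * (L - y) + 2 * π * n * y / L = ((2 * n : ℕ) : ℝ) * (2 * π) - 2 * π * n * y / L := by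
    push_cast; field_simp; ring
  rw [e1, Real.sin_nat_mul_two_pi_sub, mul_zero, zero_add]
  field_simp
  ring

/-- Case `n ≠ m`, both nonzero. -/
theorem theta_integral_offdiag {L : ℝ} (hL : 0 < L) {n m : ℕ} (hn : n ≠ 0) (hm : m ≠ 0) (hnm : n ≠ m)
    (y : ℝ) :
    ∫ x in (-(L / 2))..(L / 2 - y), xiEven L n x * xiEven L m (x + y)
      = ((n : ℝ) * Real.sin (2 * π * n * y / L) - (m : ℝ) * Real.sin (2 * π * m * y / L)) /
          (π * ((m : ℝ) ^ 2 - (n : ℝ) ^ 2)) := by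
  have hL0 : L ≠ 0 := hL.ne'
  have hnR : (n : ℝ) ≠ 0 := Nat.cast_ne_zero.2 hn
  have hmR : (m : ℝ) ≠ 0 := Nat.cast_ne_zero.2 hm
  have hnmR : (n : ℝ) - m ≠ 0 := sub_ne_zero.2 (Nat.cast_injective.ne hnm)
  have hnmR' : (n : ℝ) + m ≠ 0 := by positivity
  have hsqR : (m : ℝ) ^ 2 - (n : ℝ) ^ 2 ≠ 0 := by
    have : (m : ℝ) ^ 2 - (n : ℝ) ^ 2 = -(((n : ℝ) - m) * ((n : ℝ) + m)) := by ring
    rw [this]; exact neg_ne_zero.2 (mul_ne_zero hnmR hnmR')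
  have hc1 : 2 * π * ((n : ℝ) - m) / L ≠ 0 := by
    refine div_ne_zero (mul_ne_zero (by positivity) hnmR) hL0
  have hc2 : 2 * π * ((n : ℝ) + m) / L ≠ 0 := by positivity
  have hf : (fun u => xiEven L n (u - L / 2) * xiEven L m (u - L / 2 + y))
      = fun u => (1 / L) * Real.cos (2 * π * ((n : ℝ) - m) / L * u + -(2 * π * m * y / L))
          + (1 / L) * Real.cos (2 * π * ((n : ℝ) + m) / L * u + 2 * π * m * y / L) := by
    funext u
    rw [xiEven_sub_half hL0 hn, xiEven_sub_half_add hL0 hm]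
    have hprod := two_mul_cos_mul_cos' (2 * π * n * u / L) (2 * π * m / L * u + 2 * π * m * y / L)
    have hA : 2 * π * n * u / L - (2 * π * m / L * u + 2 * π * m * y / L)
        = 2 * π * ((n : ℝ) - m) / L * u + -(2 * π * m * y / L) := by ring
    have hB : 2 * π * n * u / L + (2 * π * m / L * u + 2 * π * m * y / L)
        = 2 * π * ((n : ℝ) + m) / L * u + 2 * π * m * y / L := by ring
    rw [hA, hB] at hprod
    have hsq := sqrt_two_div_mul hL
    calc Real.sqrt (2 / L) * Real.cos (2 * π * n * u / L)
          * (Real.sqrt (2 / L) * Real.cos (2 * π * m / L * u + 2 * π * m * y / L))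
        = (Real.sqrt (2 / L) * Real.sqrt (2 / L)) / 2
          * (2 * (Real.cos (2 * π * n * u / L) * Real.cos (2 * π * m / L * u + 2 * π * m * y / L))) := by
            ring
      _ = (2 / L) / 2 * (Real.cos (2 * π * ((n : ℝ) - m) / L * u + -(2 * π * m * y / L))
          + Real.cos (2 * π * ((n : ℝ) + m) / L * u + 2 * π * m * y / L)) := by rw [hsq, hprod]
      _ = _ := by ring
  have hi1 : IntervalIntegrable
      (fun u : ℝ => (1 / L) * Real.cos (2 * π * ((n : ℝ) - m) / L * u + -(2 * π * m * y / L))) volume 0 (L - y) :=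
    (by fun_prop : Continuous fun u : ℝ =>
      (1 / L) * Real.cos (2 * π * ((n : ℝ) - m) / L * u + -(2 * π * m * y / L))).intervalIntegrable _ _
  have hi2 : IntervalIntegrable
      (fun u : ℝ => (1 / L) * Real.cos (2 * π * ((n : ℝ) + m) / L * u + 2 * π * m * y / L)) volume 0 (L - y) :=
    (by fun_prop : Continuous fun u : ℝ =>
      (1 / L) * Real.cos (2 * π * ((n : ℝ) + m) / L * u + 2 * π * m * y / L)).intervalIntegrable _ _
  rw [theta_integral_shift, hf, intervalIntegral.integral_add hi1 hi2, intervalIntegral.integral_const_mul,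
    intervalIntegral.integral_const_mul, integral_cos_linear hc1, integral_cos_linear hc2]
  have e1 : 2 * π * ((n : ℝ) - m) / L * (L - y) + -(2 * π * m * y / L)
      = (((n : ℤ) - m : ℤ) : ℝ) * (2 * π) - 2 * π * n * y / L := by
    push_cast; field_simp; ring
  have e2 : 2 * π * ((n : ℝ) + m) / L * (L - y) + 2 * π * m * y / L
      = ((n + m : ℕ) : ℝ) * (2 * π) - 2 * π * n * y / L := by
    push_cast; field_simp; ring
  rw [e1, e2, Real.sin_int_mul_two_pi_sub, Real.sin_nat_mul_two_pi_sub, mul_zero, zero_add, mul_zero,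
    zero_add, Real.sin_neg]
  field_simp
  ring

/-! ## 4. The identity -/

/-- **INTEGRAL REPRESENTATION.** For `0 < L` and every real `y`,
`thetaEven L n m y = ∫_{-L/2}^{L/2-y} ξ_n(x) ξ_m(x+y) dx`; for `0 ≤ y ≤ L` the range is exactly the part
of the window `[-L/2, L/2]` whose `y`-translate stays in the window, so this is the windowed
autocorrelation of the modes. [folklore] -/
theorem thetaEven_eq_integral {L : ℝ} (hL : 0 < L) (n m : ℕ) (y : ℝ) :
    thetaEven L n m y = ∫ x in (-(L / 2))..(L / 2 - y), xiEven L n x * xiEven L m (x + y) := by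
  by_cases hn : n = 0 <;> by_cases hm : m = 0
  · subst hn; subst hm
    rw [theta_integral_zero_zero hL]; simp [thetaEven]
  · subst hn
    rw [theta_integral_zero_left hL hm]; simp [thetaEven, hm]
  · subst hm
    rw [theta_integral_zero_right hL hn]; simp [thetaEven, hn]
  · by_cases hnm : n = m
    · subst hnm
      rw [theta_integral_diag hL hn]; simp [thetaEven, hn]
    · rw [theta_integral_offdiag hL hn hm hnm]; simp [thetaEven, hn, hm, hnm]


end Summit.RiemannHypothesis.RiemannHypothesis.Theorems.PfPersistence

end
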